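import Mathlib
import Literature.Probability.Percolation.CriticalContinuity
import HarnessLib

/-!
# Stub `stub_leverArithmetic` of line `pocket-resampling-liveness-mass` (crux `PercBudgetLadder.PinholeClosing`, stmt-CriticalPhenomena-5249)

Lever arithmetic (pure measure theory): for a bounded measurable `D ≥ 0` with second moment at
most `K` and `{D > 1}` inside `G` a.s., the integral of `D` over `F` is at most
`P(F) + √(K · P(G))`.

Registered signature (lead prover-line-stmt-CriticalPhenomena-5249-1, skeleton
`Cruxes/PinholeClosing/Lines/pocket_resampling_liveness_mass.lean` rev 1): proved VERBATIM below as
`Summit.CriticalPhenomena.PercolationContinuityZ3.Theorems.stub_leverArithmetic`; helper lemmas live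
in `namespace StubLeverArithmetic`.  No new definitions (tree vocabulary only).

Proof route (elementary, no `Lp` machinery): for every `t > 0` the pointwise AM–GM bound
`𝟙_F D ≤ 𝟙_F + (t/2) D² + 𝟙_G/(2t)` holds a.e. (on `{D ≤ 1}` trivially, on `{1 < D} ⊆ G` because
`(t/2) D² + 1/(2t) - D = (tD-1)²/(2t) ≥ 0`); integrating gives
`∫_F D ≤ μ(F) + (t/2) K + μ(G)/(2t)`, and optimising in `t` (with the degenerate cases `K ≤ 0`,
`μ(G) = 0` handled by letting `t → ∞`, `t → 0`) yields `μ(F) + √(K μ(G))`.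
-/

noncomputable section

namespace Summit.CriticalPhenomena.PercolationContinuityZ3.Theorems

open MeasureTheory Finset
open Literature.Probability.Percolation Literature.Probability.LatticeModels
open scoped Classical

namespace StubLeverArithmetic

/-- AM–GM in the form used pointwise: `d ≤ (t/2) d² + 1/(2t)` for `t > 0`
(since the difference is `(td - 1)²/(2t)`). -/
theorem le_amgm (d t : ℝ) (ht : 0 < t) : d ≤ t / 2 * d ^ 2 + 1 / (2 * t) := by
  have h : t / 2 * d ^ 2 + 1 / (2 * t) - d = (t * d - 1) ^ 2 / (2 * t) := by
    field_simp
    ring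
  have h' : 0 ≤ (t * d - 1) ^ 2 / (2 * t) := div_nonneg (sq_nonneg _) (by positivity)
  linarith

/-- Optimising the `t`-family of bounds: if `g ≥ 0` and `I ≤ a + (t/2) K + g/(2t)` for every
`t > 0`, then `I ≤ a + √(K g)` (for `K, g > 0` take `t = √g/√K`; if `K ≤ 0` let `t → ∞`;
if `g = 0` let `t → 0`). -/
theorem le_add_sqrt_of_forall_pos (I a K g : ℝ) (hg : 0 ≤ g)
    (h : ∀ t : ℝ, 0 < t → I ≤ a + t / 2 * K + 1 / (2 * t) * g) :
    I ≤ a + Real.sqrt (K * g) := by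
  by_cases hKg : 0 < K ∧ 0 < g
  · obtain ⟨hK, hg'⟩ := hKg
    obtain ⟨sK, hsK, rfl⟩ : ∃ s, 0 < s ∧ K = s ^ 2 :=
      ⟨Real.sqrt K, Real.sqrt_pos.2 hK, (Real.sq_sqrt hK.le).symm⟩
    obtain ⟨sg, hsg, rfl⟩ : ∃ s, 0 < s ∧ g = s ^ 2 :=
      ⟨Real.sqrt g, Real.sqrt_pos.2 hg', (Real.sq_sqrt hg'.le).symm⟩
    rw [show sK ^ 2 * sg ^ 2 = (sK * sg) ^ 2 by ring, Real.sqrt_sq (by positivity)]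
    have hmain := h (sg / sK) (div_pos hsg hsK)
    have key : sg / sK / 2 * sK ^ 2 + 1 / (2 * (sg / sK)) * sg ^ 2 = sK * sg := by
      field_simp
      ring
    linarith
  · have hIa : I ≤ a := by
      refine le_of_forall_pos_le_add fun ε hε => ?_
      rcases not_and_or.1 hKg with hK | hg'
      · -- `K ≤ 0`: take `t` large.
        have hK' : K ≤ 0 := not_lt.1 hK
        have ht : 0 < g / ε + 1 := by positivity
        have hmain := h _ ht
        have h1 : (g / ε + 1) / 2 * K ≤ 0 :=
          mul_nonpos_of_nonneg_of_nonpos (by positivity) hK'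
        have h2 : 1 / (2 * (g / ε + 1)) * g ≤ ε := by
          rw [div_mul_eq_mul_div, one_mul, div_le_iff₀ (by positivity)]
          have h3 : ε * (2 * (g / ε + 1)) = 2 * g + 2 * ε := by
            field_simp
          nlinarith
        linarith
      · -- `g = 0`: take `t` small.
        have hg0 : g = 0 := le_antisymm (not_lt.1 hg') hg
        subst hg0
        have ht : 0 < ε / (|K| + 1) := by positivity
        have hmain := h _ ht
        rw [mul_zero, add_zero] at hmain
        have hKle : K ≤ |K| + 1 := (le_abs_self K).trans (le_add_of_nonneg_right zero_le_one)
        have h1 : ε / (|K| + 1) / 2 * K ≤ ε / (|K| + 1) / 2 * (|K| + 1) :=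
          mul_le_mul_of_nonneg_left hKle (by positivity)
        have h3 : ε / (|K| + 1) / 2 * (|K| + 1) = ε / 2 := by
          field_simp
        linarith
    exact hIa.trans (le_add_of_nonneg_right (Real.sqrt_nonneg _))

variable {Ω : Type*} [MeasurableSpace Ω]

/-- The `t`-family of bounds on a finite measure space: for bounded measurable `D ≥ 0` with
`{1 < D} ⊆ G` a.e. and `∫ D² ≤ K`, for every `t > 0`,
`∫_F D ≤ μ(F) + (t/2) K + μ(G)/(2t)` (integrate the pointwise AM–GM bound
`𝟙_F D ≤ 𝟙_F + (t/2) D² + 𝟙_G/(2t)`). -/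
theorem setIntegral_le_of_pos (μ : Measure Ω) [IsFiniteMeasure μ] (D : Ω → ℝ) (F G : Set Ω)
    (K B : ℝ) (hD : Measurable D) (hD0 : ∀ ω, 0 ≤ D ω) (hDB : ∀ ω, D ω ≤ B)
    (hF : MeasurableSet F) (hG : MeasurableSet G) (hae : ∀ᵐ ω ∂μ, 1 < D ω → ω ∈ G)
    (hK : ∫ ω, (D ω) ^ 2 ∂μ ≤ K) (t : ℝ) (ht : 0 < t) :
    ∫ ω in F, D ω ∂μ ≤ μ.real F + t / 2 * K + 1 / (2 * t) * μ.real G := by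
  have hDint : Integrable D μ :=
    Integrable.of_bound hD.aestronglyMeasurable B
      (ae_of_all _ fun ω => by rw [Real.norm_eq_abs, abs_of_nonneg (hD0 ω)]; exact hDB ω)
  have hD2int : Integrable (fun ω => (D ω) ^ 2) μ :=
    Integrable.of_bound (hD.pow_const 2).aestronglyMeasurable (B ^ 2)
      (ae_of_all _ fun ω => by
        rw [Real.norm_eq_abs, abs_of_nonneg (sq_nonneg _)]
        exact pow_le_pow_left₀ (hD0 ω) (hDB ω) 2)
  have h1int : Integrable (F.indicator (1 : Ω → ℝ)) μ := (integrable_const 1).indicator hF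
  have hGint : Integrable (G.indicator (1 : Ω → ℝ)) μ := (integrable_const 1).indicator hG
  -- the pointwise (a.e.) AM–GM bound
  have hpt : ∀ᵐ ω ∂μ, F.indicator D ω ≤
      F.indicator (1 : Ω → ℝ) ω + t / 2 * (D ω) ^ 2 + 1 / (2 * t) * G.indicator (1 : Ω → ℝ) ω := by
    filter_upwards [hae] with ω hω
    have h2 : 0 ≤ t / 2 * (D ω) ^ 2 := by positivity
    have h3 : 0 ≤ 1 / (2 * t) * G.indicator (1 : Ω → ℝ) ω :=
      mul_nonneg (by positivity) (Set.indicator_nonneg (fun _ _ => zero_le_one) _)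
    by_cases hωF : ω ∈ F
    · rw [Set.indicator_of_mem hωF, Set.indicator_of_mem hωF, Pi.one_apply]
      by_cases hD1 : D ω ≤ 1
      · linarith
      · have hωG : ω ∈ G := hω (lt_of_not_ge hD1)
        rw [Set.indicator_of_mem hωG, Pi.one_apply, mul_one]
        have h4 := le_amgm (D ω) t ht
        linarith
    · rw [Set.indicator_of_notMem hωF, Set.indicator_of_notMem hωF]
      linarith
  have hRint : Integrable (fun ω => F.indicator (1 : Ω → ℝ) ω + t / 2 * (D ω) ^ 2 +
      1 / (2 * t) * G.indicator (1 : Ω → ℝ) ω) μ :=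
    (h1int.fun_add (hD2int.const_mul (t / 2))).fun_add (hGint.const_mul (1 / (2 * t)))
  have hmono := integral_mono_ae (hDint.indicator hF) hRint hpt
  rw [integral_indicator hF, integral_add (h1int.fun_add (hD2int.const_mul _))
    (hGint.const_mul _), integral_add h1int (hD2int.const_mul _), integral_const_mul,
    integral_const_mul, integral_indicator_one hF, integral_indicator_one hG] at hmono
  have h4 : t / 2 * ∫ ω, (D ω) ^ 2 ∂μ ≤ t / 2 * K := mul_le_mul_of_nonneg_left hK (by positivity)
  linarith

/-- **Lever arithmetic, general form.** On a finite measure space, for bounded measurable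
`D ≥ 0` with `{1 < D} ⊆ G` a.e. and `∫ D² ≤ K`:
`∫_F D ≤ μ(F) + √(K μ(G))`. -/
theorem setIntegral_le_measureReal_add_sqrt (μ : Measure Ω) [IsFiniteMeasure μ] (D : Ω → ℝ)
    (F G : Set Ω) (K B : ℝ) (hD : Measurable D) (hD0 : ∀ ω, 0 ≤ D ω) (hDB : ∀ ω, D ω ≤ B)
    (hF : MeasurableSet F) (hG : MeasurableSet G) (hae : ∀ᵐ ω ∂μ, 1 < D ω → ω ∈ G)
    (hK : ∫ ω, (D ω) ^ 2 ∂μ ≤ K) :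
    ∫ ω in F, D ω ∂μ ≤ μ.real F + Real.sqrt (K * μ.real G) :=
  le_add_sqrt_of_forall_pos _ _ _ _ measureReal_nonneg
    (fun t ht => setIntegral_le_of_pos μ D F G K B hD hD0 hDB hF hG hae hK t ht)

end StubLeverArithmetic

/-- **Lever arithmetic** (line pocket-resampling-liveness-mass, stub 5): for the critical bond
percolation measure on `ℤ³`, a bounded measurable `D ≥ 0` with `{1 < D} ⊆ G` a.s. and second
moment at most `K` satisfies `∫_F D ≤ P(F) + √(K P(G))`. -/
theorem stub_leverArithmetic :
    ∀ (D : BondConfig (Site 3) → ℝ) (F G : Set (BondConfig (Site 3))) (K B : ℝ),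
      Measurable D → (∀ ω, 0 ≤ D ω) → (∀ ω, D ω ≤ B) → MeasurableSet F → MeasurableSet G →
      (∀ᵐ ω ∂(bondPercolation (zdGraph 3) (criticalProbI 3)), 1 < D ω → ω ∈ G) →
      ∫ ω, (D ω) ^ 2 ∂(bondPercolation (zdGraph 3) (criticalProbI 3)) ≤ K →
      ∫ ω in F, D ω ∂(bondPercolation (zdGraph 3) (criticalProbI 3)) ≤
        (bondPercolation (zdGraph 3) (criticalProbI 3)).real F +
          Real.sqrt (K * (bondPercolation (zdGraph 3) (criticalProbI 3)).real G) :=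
  fun D F G K B hD hD0 hDB hF hG hae hK =>
    StubLeverArithmetic.setIntegral_le_measureReal_add_sqrt _ D F G K B hD hD0 hDB hF hG hae hK

end Summit.CriticalPhenomena.PercolationContinuityZ3.Theorems
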